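import Summits.Ventures.HSemireg.SiegelComponentChartFromFacts
import HarnessLib

/-!
# Venture HSemireg — the chain on `𝒜_{g,δ,N}` AT ONE COMPONENT, door-agnostic («germ») form
# (red team 1, finding V4-T2: «localise so STEP-0 bets on the chart at ONE component»)

HONEST FRAMING. Assembly file of the computation cell `pub-hsemireg` (Lean seat p3, composition duty); nothing is claimed
about any variety and nothing here says that HC / HC_CM / HC_AV holds — every theorem carries its inputs BY NAME. No
definition is declared in this file.

Theory seat 3's 𝒜_g-form of the transfer chain (`SiegelComponentChart.lean`) and the cell's object doors built on it
(`SiegelComponentChartReducible.lean`, `SiegelComponentChartSheaf.lean`, `SiegelComponentChartSubscheme.lean`) take the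
chart assumption `SiegelHodgeLocusChart g δ N` — a statement about EVERY datum, degree and component — and use it exactly
once, at their own `(D, p, C)`; theory seat 2 derived it from the base chart `SiegelHodgeLocusBaseChart g δ N` and
Deligne's théorème de la partie fixe (`siegelHodgeLocusChart_of_baseChart`), again componentwise. This file isolates the
two componentwise steps, with the chart clauses AT ONE COMPONENT written out (they are, by `Iff.rfl`, theory seat 3's
named forms `SiegelHodgeLocusChartAt D p C` / `SiegelHodgeLocusBaseChartAt D p C` of `SiegelComponentChartAt.lean`, so
a holder of those applies the theorems below directly):

* `exists_siegelChartAt_of_baseChartAt` — base-chart data `(T, ρ, τ)` at `(D, p, C)` ∧ `deligne_globalInvariantCycles`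
  ⟹ the chart clause at `(D, p, C)` (theory seat 2's proof of `siegelHodgeLocusChart_of_baseChart`, which consumes the
  base chart at one component only — red team 1, probe P2).
* `hc_on_siegelComponent_of_germ_of_smul_add_at` — THE CHAIN AT ONE COMPONENT FOR AN ABSTRACT DOOR: granted the chart
  clause at `(D, p, C)`, a global class `Λ` of the universal family fibrewise rational `(p,p)` and algebraic, a point
  `(t₀, α₀) ∈ C`, rationals `a ≠ 0`, `b`, `μ ≠ 0` and a class `X` on `𝒴_{t₀}` with `a·α₀ + b·Λ|_{t₀} = μ·X` such that
  `X` SPREADS — along every smooth projective family over a smooth quasi-projective base with a fibre identified with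
  `𝒴_{t₀}`, every global class fibrewise rational `(p,p)` taking the value `X` there is algebraic on an OPEN
  NEIGHBOURHOOD of that fibre (VERBATIM the output clause of the tree's semiregularity facts `BlochSemiregularSpread`,
  `BlochSemiregularSpreadSmoothComponents`, `BlochSemiregularSpreadOfSubscheme`, with their object binders stripped) —
  the class `α` is algebraic for EVERY `(t, α) ∈ C`. Every object door of the cell on `𝒜_g` is this theorem with
  `hgerm :=` its named fact applied to its object; the globalisation on the irreducible chart (Bloch's countable-union
  step, `charlesSchnell_algebraicityLocus_iUnion_closed.forall_mem_algebraicClasses_of_isOpen`, fact DISCHARGED in the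
  tree) and the unscaling by `μ`, `a` are done here once.
* `hc_on_siegelComponent_of_germ_of_smul_add_of_baseChartAt` — the same on base-chart data at `(D, p, C)` ∧
  `deligne_globalInvariantCycles`.

References: [Bloch1972Semiregularity] Thm. (7.4) with proof (last paragraph), Remark (7.5), p. 65; [BuchweitzFlenner2003]
Thm. 5.2; [CattaniDeligneKaplan1995JAMS] Thm. 1.1, Cor. 1.2; [DeligneHodgeII1971] Thm. 4.1.1; [CharlesSchnell2014Notes]
Prop. 11.3.11; [Voisin2007HodgeLoci] §3.
-/

noncomputable section

open CategoryTheory AlgebraicGeometry Set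
open Literature.AlgebraicGeometry.Motives Literature.AlgebraicGeometry.HodgeTheory
open Literature.AlgebraicGeometry.ModuliOfAbelianVarieties Literature.AlgebraicGeometry.Deligne1982
open Literature.AlgebraicTopology.SingularHomology

namespace Summit.Ventures.HSemireg

local notation3 (prettyPrint := false) "Res[" f ", " s ", " k ", " A "]" =>
  complexBetti.map (Literature.AlgebraicGeometry.Motives.fiberι f s) k A

section Siegel

variable {g : ℕ} {δ : Fin g → ℕ} {N : ℕ}

/-- **The chart clause at one component from base-chart data at that component** (per-component form of theory seat
2's `siegelHodgeLocusChart_of_baseChart`, whose proof consumes `SiegelHodgeLocusBaseChart` at ONE `(D, p, C)`; red team 1,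
probe P2). Given `(T, ρ, τ)` — `T` smooth irreducible quasi-projective, `ρ : T ⟶ D.S`, `τ` continuous over `ρ` onto
`C.carrier` — and Deligne's théorème de la partie fixe, the chart is the base-changed universal family `D.𝒳 ×_{D.S} T ⟶ T`,
`Φ` its first projection, `W` the global class of `exists_sweepingClass_of_baseChart`. Hypothesis and conclusion are the
clauses of `SiegelHodgeLocusBaseChart` / `SiegelHodgeLocusChart` at `(D, p, C)`, written out.
[cite: DeligneHodgeII1971, Théorème 4.1.1] [cite: MoonenOort2013Torelli, §3 Def. (Version 2) and (d)]
[cite: Voisin2007HodgeLoci, §3, proof of Prop. 0.7] -/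
theorem exists_siegelChartAt_of_baseChartAt {D : SiegelModuliDatum g δ N} {p : ℕ} {C : HodgeLocusComponent D.f g p}
    (hS : ∃ (T : SchemeOver ℂ) (ρ : T ⟶ D.S) (τ : ComplexPoints T → FiberClass D.f (2 * p)),
      IsQuasiProjectiveOver T ∧ _root_.AlgebraicGeometry.Smooth T.hom ∧ IrreducibleSpace T.left ∧
      Continuous τ ∧ (∀ u : ComplexPoints T, (τ u).pt = AlgPoints.map ρ u) ∧ Set.range τ = C.carrier)
    (hGIC : deligne_globalInvariantCycles) :
    ∃ (𝒳 T : SchemeOver ℂ) (f : 𝒳 ⟶ T) (Φ : 𝒳 ⟶ D.𝒳) (W : complexBetti 𝒳 (2 * p)),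
      IsSmoothProjectiveFamily f g ∧ IsQuasiProjectiveOver 𝒳 ∧ IsQuasiProjectiveOver T ∧
      _root_.AlgebraicGeometry.Smooth T.hom ∧ IrreducibleSpace T.left ∧
      (∀ u : ComplexPoints T, IsRationalClass (Res[f, u, 2 * p, W]) ∧
        IsOfHodgeType g (fiberOver f u) (2 * p) p p (Res[f, u, 2 * p, W])) ∧
      (∀ u : ComplexPoints T, ∃ (s : ComplexPoints D.S) (e : fiberOver f u ≅ fiberOver D.f s),
        e.hom ≫ fiberι D.f s = fiberι f u ≫ Φ) ∧
      (∀ x ∈ C.carrier, ∃ (u : ComplexPoints T) (e : fiberOver f u ≅ fiberOver D.f x.pt),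
        e.hom ≫ fiberι D.f x.pt = fiberι f u ≫ Φ ∧ complexBetti.map e.hom (2 * p) x.cls = Res[f, u, 2 * p, W]) := by
  obtain ⟨T, ρ, τ, hT, hTs, hTi, hτc, hτpt, hτC⟩ := hS
  haveI := hTi
  haveI : _root_.AlgebraicGeometry.Smooth T.hom := hTs
  haveI : _root_.AlgebraicGeometry.Smooth D.S.hom := D.smooth_base
  haveI : IsSeparated D.S.hom := isSeparated_hom_of_isQuasiProjectiveOver D.isQuasiProjectiveOver_base
  have hf : IsSmoothProjectiveFamily (familyPullback.snd D.f ρ) g := D.isSmoothProjectiveFamily.familyPullback_snd ρ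
  have h𝒳 : IsQuasiProjectiveOver (familyPullback D.f ρ) :=
    isQuasiProjectiveOver_familyPullback_of_isSeparated D.f ρ D.isQuasiProjectiveOver_total hT
  have hτH : ∀ u, τ u ∈ locusOfHodgeClasses D.f g p := fun u =>
    C.carrier_subset (by rw [← hτC]; exact Set.mem_range_self u)
  obtain ⟨x₀, hx₀⟩ := C.carrier_nonempty
  have hx₀' : x₀ ∈ Set.range τ := by rw [hτC]; exact hx₀
  obtain ⟨u₀, -⟩ := hx₀'
  obtain ⟨W, hWH, hWτ⟩ := exists_sweepingClass_of_baseChart D.f ρ hGIC D.isSmoothProjectiveFamily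
    D.isQuasiProjectiveOver_total D.isQuasiProjectiveOver_base hT hτc hτpt hτH u₀
  refine ⟨familyPullback D.f ρ, T, familyPullback.snd D.f ρ, familyPullback.fst D.f ρ, W, hf, h𝒳, hT, hTs,
    hTi, hWH, fun u => ⟨AlgPoints.map ρ u, fiberOverFamilyPullbackIso D.f ρ u,
      fiberOverFamilyPullbackIso_hom_fiberι D.f ρ u⟩, fun x hx => ?_⟩
  have hx' : x ∈ Set.range τ := by rw [hτC]; exact hx
  obtain ⟨u, rfl⟩ := hx'
  rw [hWτ u]
  refine ⟨u, fiberOverFamilyPullbackIso D.f ρ u, fiberOverFamilyPullbackIso_hom_fiberι D.f ρ u, ?_⟩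
  change complexBetti.map (fiberOverFamilyPullbackIso D.f ρ u).hom (2 * p)
      (complexBetti.map (fiberOverFamilyPullbackIso D.f ρ u).inv (2 * p)
        (Res[familyPullback.snd D.f ρ, u, 2 * p, W])) = Res[familyPullback.snd D.f ρ, u, 2 * p, W]
  rw [(fiberOverFamilyPullbackIso D.f ρ u).complexBetti_map_hom_map_inv]

/-- **The chain on 𝒜_{g,δ,N} at ONE component, Remark (7.5) form, for an ABSTRACT DOOR.** Inputs: the chart clause of
`SiegelHodgeLocusChart` at `(D, p, C)` (`hA`, written out; = theory seat 3's `SiegelHodgeLocusChartAt D p C`); a global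
class `Λ` of the universal family, fibrewise rational of type `(p,p)` and fibrewise algebraic (a power of the relative
polarisation); a point `(t₀, α₀) ∈ C`; `a, b, μ ∈ ℚ`, `a ≠ 0`, `μ ≠ 0`, and a class `X ∈ H²ᵖ(𝒴_{t₀}(ℂ); ℂ)` with
`a·α₀ + b·Λ|_{t₀} = μ·X` (for the cell: `X` = the class of the semiregular object, `q·hⁿ + w = μ·[Z]`); and the GERM
CLAUSE `hgerm` for `X`: along every smooth projective family `f : 𝒳 ⟶ T` of relative dimension `g` (`𝒳`, `T`
quasi-projective, `T` smooth) with an identification `e : 𝒴_{t₀} ≅ 𝒳_{u₀}`, every global class `V` fibrewise rational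
`(p,p)` with `e^*(V|_{u₀}) = X` is algebraic on the fibres over an OPEN `U ∋ u₀` — verbatim the conclusion of the tree's
semiregularity facts (`BlochSemiregularSpread`, `…SmoothComponents`, `…OfSubscheme`: Bloch (7.4)/(7.5), BF Thm. 5.2) for
their respective objects. Conclusion: `α` is algebraic for EVERY `(t, α) ∈ C`. Proof (th-3's, door-agnostic): on the
chart `(f, Φ, W)` put `L := Φ^*Λ`, `V' := μ⁻¹·(a·W + b·L)`; `V'` is global, fibrewise rational `(p,p)`, with
`e₀⁻¹`-value `X` at the chart point `u₀` over `t₀`; `hgerm` + Bloch's countable-union step on the IRREDUCIBLE chart base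
(`charlesSchnell_algebraicityLocus_iUnion_closed.forall_mem_algebraicClasses_of_isOpen`, fact discharged in the tree) make
`V'` algebraic on every chart fibre; `L` is (each chart fibre is a fibre of `D.f`); hence `W` is (`a ≠ 0`); sweep.
[cite: Bloch1972Semiregularity, Thm. (7.4) with proof, and Remark (7.5), p. 65] [cite: BuchweitzFlenner2003, Thm. 5.2]
[cite: CattaniDeligneKaplan1995JAMS, Thm. 1.1 and Cor. 1.2] [cite: CharlesSchnell2014Notes, Prop. 11.3.11] -/
theorem hc_on_siegelComponent_of_germ_of_smul_add_at {p : ℕ} {D : SiegelModuliDatum g δ N}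
    {C : HodgeLocusComponent D.f g p}
    (hA : ∃ (𝒳 T : SchemeOver ℂ) (f : 𝒳 ⟶ T) (Φ : 𝒳 ⟶ D.𝒳) (W : complexBetti 𝒳 (2 * p)),
      IsSmoothProjectiveFamily f g ∧ IsQuasiProjectiveOver 𝒳 ∧ IsQuasiProjectiveOver T ∧
      _root_.AlgebraicGeometry.Smooth T.hom ∧ IrreducibleSpace T.left ∧
      (∀ u : ComplexPoints T, IsRationalClass (Res[f, u, 2 * p, W]) ∧
        IsOfHodgeType g (fiberOver f u) (2 * p) p p (Res[f, u, 2 * p, W])) ∧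
      (∀ u : ComplexPoints T, ∃ (s : ComplexPoints D.S) (e : fiberOver f u ≅ fiberOver D.f s),
        e.hom ≫ fiberι D.f s = fiberι f u ≫ Φ) ∧
      (∀ x ∈ C.carrier, ∃ (u : ComplexPoints T) (e : fiberOver f u ≅ fiberOver D.f x.pt),
        e.hom ≫ fiberι D.f x.pt = fiberι f u ≫ Φ ∧ complexBetti.map e.hom (2 * p) x.cls = Res[f, u, 2 * p, W]))
    (Λ : complexBetti D.𝒳 (2 * p))
    (hΛ : ∀ s : ComplexPoints D.S, IsRationalClass (Res[D.f, s, 2 * p, Λ]) ∧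
      IsOfHodgeType g (fiberOver D.f s) (2 * p) p p (Res[D.f, s, 2 * p, Λ]))
    (hΛalg : ∀ s : ComplexPoints D.S, Res[D.f, s, 2 * p, Λ] ∈ algebraicClasses (fiberOver D.f s) p)
    {x₀ : FiberClass D.f (2 * p)} (hx₀ : x₀ ∈ C.carrier) (a b : ℚ) (ha : a ≠ 0)
    (X : complexBetti (fiberOver D.f x₀.pt) (2 * p)) (μ : ℚ) (hμ : μ ≠ 0)
    (hcls : (a : ℂ) • x₀.cls + (b : ℂ) • Res[D.f, x₀.pt, 2 * p, Λ] = ((μ : ℚ) : ℂ) • X)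
    (hgerm : ∀ (𝒳 T : SchemeOver ℂ) (f : 𝒳 ⟶ T) (u₀ : ComplexPoints T)
        (e : fiberOver D.f x₀.pt ≅ fiberOver f u₀) (V : complexBetti 𝒳 (2 * p)),
      IsSmoothProjectiveFamily f g → IsQuasiProjectiveOver 𝒳 → IsQuasiProjectiveOver T →
      _root_.AlgebraicGeometry.Smooth T.hom →
      (∀ u : ComplexPoints T, IsRationalClass (Res[f, u, 2 * p, V]) ∧
        IsOfHodgeType g (fiberOver f u) (2 * p) p p (Res[f, u, 2 * p, V])) →
      complexBetti.map e.hom (2 * p) (Res[f, u₀, 2 * p, V]) = X →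
      ∃ U : Set (ComplexPoints T), IsOpen U ∧ u₀ ∈ U ∧
        ∀ t ∈ U, Res[f, t, 2 * p, V] ∈ algebraicClasses (fiberOver f t) p) :
    ∀ x ∈ C.carrier, x.cls ∈ algebraicClasses (fiberOver D.f x.pt) p := by
  obtain ⟨𝒳, T, f, Φ, W, hf, h𝒳, hT, hTs, hTi, hW, hΦ, hsw⟩ := hA
  haveI := hTi
  -- the pulled-back class `L = Φ^*Λ` and its fibrewise properties (every chart fibre is a fibre of `D.f`)
  set L : complexBetti 𝒳 (2 * p) := complexBetti.map Φ (2 * p) Λ with hLdef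
  have hLfib : ∀ u : ComplexPoints T, (IsRationalClass (Res[f, u, 2 * p, L]) ∧
      IsOfHodgeType g (fiberOver f u) (2 * p) p p (Res[f, u, 2 * p, L])) ∧
      Res[f, u, 2 * p, L] ∈ algebraicClasses (fiberOver f u) p := by
    intro u
    obtain ⟨s, e, he⟩ := hΦ u
    have hres : Res[f, u, 2 * p, L] = complexBetti.map e.hom (2 * p) (Res[D.f, s, 2 * p, Λ]) := by
      rw [hLdef, map_res_eq_res_map_of_comm e he]
    rw [hres]
    exact ⟨⟨(isRationalClass_map_iff_of_iso e).2 (hΛ s).1, (isOfHodgeType_map_iff_of_iso e).2 (hΛ s).2⟩,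
      (mem_algebraicClasses_map_iff_of_iso e).2 (hΛalg s)⟩
  -- the special point on the chart and the rescaled combined global class `V' = μ⁻¹·(a·W + b·L)`
  obtain ⟨u₀, e₀, he₀Φ, he₀⟩ := hsw x₀ hx₀
  set V : complexBetti 𝒳 (2 * p) := (a : ℂ) • W + (b : ℂ) • L with hVdef
  have hVres : ∀ u : ComplexPoints T, Res[f, u, 2 * p, V] =
      (a : ℂ) • Res[f, u, 2 * p, W] + (b : ℂ) • Res[f, u, 2 * p, L] := fun u => by
    simp only [hVdef, map_add, map_smul]
  have hVhodge : ∀ u : ComplexPoints T, IsRationalClass (Res[f, u, 2 * p, V]) ∧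
      IsOfHodgeType g (fiberOver f u) (2 * p) p p (Res[f, u, 2 * p, V]) := fun u => by
    rw [hVres u]
    exact ⟨((hW u).1.smul a).add ((hLfib u).1.1.smul b),
      ((hW u).2.smul (a : ℂ)).add (hf.isSmoothProjective u) ((hLfib u).1.2.smul (b : ℂ))⟩
  set V' : complexBetti 𝒳 (2 * p) := ((μ⁻¹ : ℚ) : ℂ) • V with hV'def
  have hV'res : ∀ u : ComplexPoints T, Res[f, u, 2 * p, V'] = ((μ⁻¹ : ℚ) : ℂ) • Res[f, u, 2 * p, V] := fun u => by
    rw [hV'def, map_smul]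
  have hV'hodge : ∀ u : ComplexPoints T, IsRationalClass (Res[f, u, 2 * p, V']) ∧
      IsOfHodgeType g (fiberOver f u) (2 * p) p p (Res[f, u, 2 * p, V']) := fun u => by
    rw [hV'res u]
    exact ⟨(hVhodge u).1.smul μ⁻¹, (hVhodge u).2.smul _⟩
  have hVx : complexBetti.map e₀.symm.hom (2 * p) (Res[f, u₀, 2 * p, V]) =
      (a : ℂ) • x₀.cls + (b : ℂ) • Res[D.f, x₀.pt, 2 * p, Λ] := by
    rw [hVres u₀, ← he₀, hLdef, ← map_res_eq_res_map_of_comm e₀ he₀Φ, Iso.symm_hom, map_add, map_smul, map_smul,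
      e₀.complexBetti_map_inv_map_hom, e₀.complexBetti_map_inv_map_hom]
  have hV'x : complexBetti.map e₀.symm.hom (2 * p) (Res[f, u₀, 2 * p, V']) = X := by
    rw [hV'res u₀, map_smul, hVx, hcls, smul_smul, ← Rat.cast_mul, inv_mul_cancel₀ hμ, Rat.cast_one, one_smul]
  -- the door's germ of algebraicity at `u₀`, GLOBAL on the irreducible chart (Bloch's countable-union step)
  have hV'all : ∀ u : ComplexPoints T, Res[f, u, 2 * p, V'] ∈ algebraicClasses (fiberOver f u) p := by
    obtain ⟨U, hU, hu₀, hUA⟩ := hgerm 𝒳 T f u₀ e₀.symm V' hf h𝒳 hT hTs hV'hodge hV'x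
    exact charlesSchnell_algebraicityLocus_iUnion_closed.forall_mem_algebraicClasses_of_isOpen
      charlesSchnell_algebraicityLocus_iUnion_closed_holds f g p h𝒳 hT hTs hf V' hU ⟨u₀, hu₀⟩ hUA
  have hVall : ∀ u : ComplexPoints T, Res[f, u, 2 * p, V] ∈ algebraicClasses (fiberOver f u) p := by
    intro u
    have h := Submodule.smul_mem _ ((μ : ℚ) : ℂ) (hV'all u)
    rwa [hV'res u, smul_smul, ← Rat.cast_mul, mul_inv_cancel₀ hμ, Rat.cast_one, one_smul] at h
  have ha' : (a : ℂ) ≠ 0 := by exact_mod_cast ha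
  have hWalg : ∀ u : ComplexPoints T, Res[f, u, 2 * p, W] ∈ algebraicClasses (fiberOver f u) p := by
    intro u
    have h1 : (a : ℂ) • Res[f, u, 2 * p, W] ∈ algebraicClasses (fiberOver f u) p := by
      have := Submodule.sub_mem _ (hVall u) (Submodule.smul_mem _ (b : ℂ) (hLfib u).2)
      rwa [hVres u, add_sub_cancel_right] at this
    have h2 := Submodule.smul_mem _ (a : ℂ)⁻¹ h1
    rwa [smul_smul, inv_mul_cancel₀ ha', one_smul] at h2
  have hsweep : SweepsClasses D.f f W C.carrier := fun x hx => by
    obtain ⟨u, e, -, he⟩ := hsw x hx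
    exact ⟨u, e, he⟩
  exact fun x hx => hsweep.mem_algebraicClasses hWalg hx

/-- **The chain on 𝒜_{g,δ,N} at ONE component for an abstract door — on base-chart data at that component** (`hS` = the
clause of `SiegelHodgeLocusBaseChart` at `(D, p, C)`, written out; = theory seat 3's `SiegelHodgeLocusBaseChartAt D p C`)
**and Deligne's théorème de la partie fixe**: `hc_on_siegelComponent_of_germ_of_smul_add_at` composed with
`exists_siegelChartAt_of_baseChartAt`. [cite: Bloch1972Semiregularity, Thm. (7.4) with proof, and Remark (7.5), p. 65]
[cite: DeligneHodgeII1971, Théorème 4.1.1] [cite: MoonenOort2013Torelli, §3 Def. (Version 2) and (d)] -/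
theorem hc_on_siegelComponent_of_germ_of_smul_add_of_baseChartAt {p : ℕ} {D : SiegelModuliDatum g δ N}
    {C : HodgeLocusComponent D.f g p}
    (hS : ∃ (T : SchemeOver ℂ) (ρ : T ⟶ D.S) (τ : ComplexPoints T → FiberClass D.f (2 * p)),
      IsQuasiProjectiveOver T ∧ _root_.AlgebraicGeometry.Smooth T.hom ∧ IrreducibleSpace T.left ∧
      Continuous τ ∧ (∀ u : ComplexPoints T, (τ u).pt = AlgPoints.map ρ u) ∧ Set.range τ = C.carrier)
    (hGIC : deligne_globalInvariantCycles)
    (Λ : complexBetti D.𝒳 (2 * p))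
    (hΛ : ∀ s : ComplexPoints D.S, IsRationalClass (Res[D.f, s, 2 * p, Λ]) ∧
      IsOfHodgeType g (fiberOver D.f s) (2 * p) p p (Res[D.f, s, 2 * p, Λ]))
    (hΛalg : ∀ s : ComplexPoints D.S, Res[D.f, s, 2 * p, Λ] ∈ algebraicClasses (fiberOver D.f s) p)
    {x₀ : FiberClass D.f (2 * p)} (hx₀ : x₀ ∈ C.carrier) (a b : ℚ) (ha : a ≠ 0)
    (X : complexBetti (fiberOver D.f x₀.pt) (2 * p)) (μ : ℚ) (hμ : μ ≠ 0)
    (hcls : (a : ℂ) • x₀.cls + (b : ℂ) • Res[D.f, x₀.pt, 2 * p, Λ] = ((μ : ℚ) : ℂ) • X)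
    (hgerm : ∀ (𝒳 T : SchemeOver ℂ) (f : 𝒳 ⟶ T) (u₀ : ComplexPoints T)
        (e : fiberOver D.f x₀.pt ≅ fiberOver f u₀) (V : complexBetti 𝒳 (2 * p)),
      IsSmoothProjectiveFamily f g → IsQuasiProjectiveOver 𝒳 → IsQuasiProjectiveOver T →
      _root_.AlgebraicGeometry.Smooth T.hom →
      (∀ u : ComplexPoints T, IsRationalClass (Res[f, u, 2 * p, V]) ∧
        IsOfHodgeType g (fiberOver f u) (2 * p) p p (Res[f, u, 2 * p, V])) →
      complexBetti.map e.hom (2 * p) (Res[f, u₀, 2 * p, V]) = X →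
      ∃ U : Set (ComplexPoints T), IsOpen U ∧ u₀ ∈ U ∧
        ∀ t ∈ U, Res[f, t, 2 * p, V] ∈ algebraicClasses (fiberOver f t) p) :
    ∀ x ∈ C.carrier, x.cls ∈ algebraicClasses (fiberOver D.f x.pt) p :=
  hc_on_siegelComponent_of_germ_of_smul_add_at (exists_siegelChartAt_of_baseChartAt hS hGIC) Λ hΛ hΛalg hx₀ a b ha X
    μ hμ hcls hgerm

end Siegel

end Summit.Ventures.HSemireg

end
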